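import Mathlib
import HarnessLib
import Summits.NavierStokesRegularity.NavierStokesRegularity.Theorems.PoloidalWindowDoorPoloidalWindowRigidityUntwistedStuartTranslation
import Summits.NavierStokesRegularity.NavierStokesRegularity.Theorems.PoloidalWindowDoorPoloidalWindowRigidityUntwistedStuartBranch

/-!
# Route `PoloidalWindowDoor`, crux `PoloidalWindowRigidity` (K2, stmt-NavierStokesRegularity-19708), skeleton `lrc-jet` v5,
# stub `stub_untwisted` — brick F4-tr-d (part 2): PLANE CALCULUS OF LEAFWISE QUANTITIES AND THE TWO SEPARATIONS

Cell ns-regularity-ideate, K2 lead ns-poloidal-K2-p1 (gen 6; `--supports stmt-NavierStokesRegularity-19708`, helper; BRIEF-v5-bricks-v2 (S4)).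
Continuation of `…UntwistedStuartTranslation` (part 1).  On the vertical coordinate plane `Y(t,z) = y₀ + t e_b + (z − (y₀)₂)e₂` of an untwisted germ
(`∂₂w = P(w,y₂)` on `U`), with leaf point `p(t,z) = (w(Y), z)`:
* `proportional_of_transport` — two solutions of `y′ = a(z)y` are proportional (brick F4-tr-b, restated: the module `…LinearODEUniqueness` is not buildable on the hub);
* `hasDerivAt_leaf_plane_vert`, `hasDerivAt_leaf_plane_horiz` — for a function `G` of `(w,z)` differentiable at `p`: `∂_z G(p(t,z)) = DG(p)(P(p),1)` and
  `∂_t G(p(t,z)) = ∂_b w(Y)·DG(p)(1,0)`;  `hasDerivAt_wb_z` — `∂_z ∂_b w(Y) = Pw(p)·∂_b w(Y)`;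
* `eta_const` — on the Branch-2b region (`D₁ = 0` at the plane points) `η(p(t,z)) = η(p(0,z))` (`η = Pw + Ld/Λ`);
* `Qu_separation` — **`Qu(t,z)·Qu(0,z₀) = Qu(t,z₀)·Qu(0,z)`** for `Qu = Λ(p)·∂_b w(Y)` (two solutions of `y′ = η(p(0,z))·y`, brick F4-tr-b);
* `c_separation` — **`c(p(t,z))·Qu(0,z₀) = c(p(t,z₀))·Qu(0,z)`** for the leafwise second vertical derivative `c = DP(·)(P,1)` (`= ∂₂²w` on leaves), from the
  consistency relation `Λ·ċ = (Ld + ΛPw)·c` (`D₂ = 0`, a consequence of the divergence identity, its height-derivative and `D₁ = 0`).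
The final part assembles (α), (β) and calls `stuartBranch_false`.

WHAT THIS IS NOT: not a claim about Navier–Stokes — calculus bookkeeping (bears_on LADDER-NS N0 via crux K2 = stmt-19708).
-/

noncomputable section

-- the summit and its single sub-problem share the name (CONVENTIONS §1), as in every Theorems file
set_option linter.dupNamespace false

namespace Summit.NavierStokesRegularity.NavierStokesRegularity.Theorems.PoloidalWindowDoorPoloidalWindowRigidityUntwistedStuartTranslation2

open Set Function Filter Topology Metric
open Summit.NavierStokesRegularity.NavierStokesRegularity.Theorems.PoloidalWindowDoorPoloidalWindowRigidityConstantShearMeans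
open Summit.NavierStokesRegularity.NavierStokesRegularity.Theorems.PoloidalWindowDoorLrcModEntireLeafwiseVertical
open Summit.NavierStokesRegularity.NavierStokesRegularity.Theorems.PoloidalWindowDoorPoloidalWindowRigidityUntwistedSeparation
open Summit.NavierStokesRegularity.NavierStokesRegularity.Theorems.PoloidalWindowDoorPoloidalWindowRigidityUntwistedBracket
open Summit.NavierStokesRegularity.NavierStokesRegularity.Theorems.PoloidalWindowDoorPoloidalWindowRigidityUntwistedLogDerivatives
open Summit.NavierStokesRegularity.NavierStokesRegularity.Theorems.PoloidalWindowDoorPoloidalWindowRigidityUntwistedStuartTranslation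

/-! ### Proportionality of two quantities with the same vertical logarithmic derivative -/

section LinearODE

/-- **Two solutions of the same scalar linear ODE are proportional** (multiplicative separation of variables): if `f′ = a·f` and `g′ = a·g` along the
segment `uIcc z₀ z`, `a` continuous there, then `f z · g z₀ = f z₀ · g z`.  (Grönwall uniqueness for `h := f·g(z₀) − f(z₀)·g`, which solves `h′ = a h`,
`h(z₀) = 0`.)  Same content as `…LinearODEUniqueness` (p550544), restated in bundled form here because that module's hub build is unavailable
(its importers cannot be verified). [folklore] -/
theorem proportional_of_transport {f g a : ℝ → ℝ} {z₀ z : ℝ} (ha : ContinuousOn a (uIcc z₀ z))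
    (hfg : ∀ ζ ∈ uIcc z₀ z, HasDerivAt f (a ζ * f ζ) ζ ∧ HasDerivAt g (a ζ * g ζ) ζ) : f z * g z₀ = f z₀ * g z := by
  set h : ℝ → ℝ := fun ζ => f ζ * g z₀ - f z₀ * g ζ with hh
  have hderiv : ∀ ζ ∈ uIcc z₀ z, HasDerivAt h (a ζ * h ζ) ζ := by
    intro ζ hζ
    have h1 := ((hfg ζ hζ).1.mul_const (g z₀)).sub ((hfg ζ hζ).2.const_mul (f z₀))
    refine h1.congr_deriv ?_
    simp only [hh]
    ring
  have h0 : h z₀ = 0 := by simp only [hh]; ring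
  -- Grönwall: `h ≡ 0` on the segment
  suffices hz : h z = 0 by simp only [hh] at hz; linarith
  obtain ⟨K, hK⟩ := (isCompact_uIcc (a := z₀) (b := z)).exists_bound_of_continuousOn ha
  have hcont : ContinuousOn h (uIcc z₀ z) := fun ζ hζ => (hderiv ζ hζ).continuousAt.continuousWithinAt
  have hbound : ∀ ζ ∈ uIcc z₀ z, ‖a ζ * h ζ‖ ≤ K * ‖h ζ‖ + 0 := by
    intro ζ hζ
    rw [norm_mul, add_zero]
    exact mul_le_mul_of_nonneg_right (hK ζ hζ) (norm_nonneg _)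
  rcases le_total z₀ z with hle | hle
  · have hI : uIcc z₀ z = Icc z₀ z := uIcc_of_le hle
    have hg := norm_le_gronwallBound_of_norm_deriv_right_le (f := h) (f' := fun ζ => a ζ * h ζ) (δ := 0) (K := K) (ε := 0)
      (a := z₀) (b := z) (by rw [← hI]; exact hcont)
      (fun x hx => (hderiv x (by rw [hI]; exact Ico_subset_Icc_self hx)).hasDerivWithinAt)
      (by rw [h0, norm_zero]) (fun x hx => hbound x (by rw [hI]; exact Ico_subset_Icc_self hx)) z (right_mem_Icc.mpr hle)
    rw [gronwallBound_ε0_δ0] at hg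
    exact norm_le_zero_iff.mp hg
  · have hI : uIcc z₀ z = Icc z z₀ := uIcc_of_ge hle
    set γ : ℝ → ℝ := fun τ => h (-τ) with hγ
    have hγderiv : ∀ τ ∈ Icc (-z₀) (-z), HasDerivAt γ (-(a (-τ) * h (-τ))) τ := by
      intro τ hτ
      have hmem : -τ ∈ uIcc z₀ z := by
        rw [hI]; exact ⟨by linarith [hτ.2], by linarith [hτ.1]⟩
      have h1 := (hderiv (-τ) hmem).scomp τ (hasDerivAt_neg τ)
      have h1' : HasDerivAt (fun τ' => h (-τ')) ((-1 : ℝ) • (a (-τ) * h (-τ))) τ := h1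
      simpa using h1'
    have hγcont : ContinuousOn γ (Icc (-z₀) (-z)) := fun τ hτ => (hγderiv τ hτ).continuousAt.continuousWithinAt
    have hg := norm_le_gronwallBound_of_norm_deriv_right_le (f := γ) (f' := fun τ => -(a (-τ) * h (-τ))) (δ := 0) (K := K) (ε := 0)
      (a := -z₀) (b := -z) hγcont (fun x hx => (hγderiv x (Ico_subset_Icc_self hx)).hasDerivWithinAt)
      (by simp [hγ, h0]) (fun x hx => by
        have hmem : -x ∈ uIcc z₀ z := by
          rw [hI]; exact ⟨by linarith [hx.2], by linarith [hx.1]⟩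
        rw [norm_neg]
        simpa [hγ] using hbound (-x) hmem) (-z) (right_mem_Icc.mpr (by linarith))
    rw [gronwallBound_ε0_δ0] at hg
    have : γ (-z) = 0 := norm_le_zero_iff.mp hg
    simpa [hγ] using this

end LinearODE

section Plane

variable {w : EuclideanSpace ℝ (Fin 3) → ℝ} {P Λ : ℝ × ℝ → ℝ} {U : Set (EuclideanSpace ℝ (Fin 3))}
  {y₀ : EuclideanSpace ℝ (Fin 3)} {b : Fin 3}

/-! ### Leafwise quantities along the plane -/

/-- **Vertical derivative of a leafwise quantity along the plane**: `∂_z G(w(Y(t,z)), z) = DG(p)(P(p), 1)`. [folklore] -/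
theorem hasDerivAt_leaf_plane_vert (hw : ContDiff ℝ 2 w) (hb : b ≠ 2)
    (hP : ∀ y ∈ U, fderiv ℝ w y (EuclideanSpace.single 2 (1 : ℝ)) = P (w y, y 2)) {G : ℝ × ℝ → ℝ} {t z : ℝ}
    (hY : y₀ + t • EuclideanSpace.single b (1 : ℝ) + (z - y₀ 2) • EuclideanSpace.single (2 : Fin 3) (1 : ℝ) ∈ U)
    (hG : DifferentiableAt ℝ G (w (y₀ + t • EuclideanSpace.single b (1 : ℝ) + (z - y₀ 2) • EuclideanSpace.single (2 : Fin 3) (1 : ℝ)), z)) :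
    HasDerivAt (fun z' : ℝ => G (w (y₀ + t • EuclideanSpace.single b (1 : ℝ) + (z' - y₀ 2) • EuclideanSpace.single (2 : Fin 3) (1 : ℝ)), z'))
      (fderiv ℝ G (w (y₀ + t • EuclideanSpace.single b (1 : ℝ) + (z - y₀ 2) • EuclideanSpace.single (2 : Fin 3) (1 : ℝ)), z)
        (P (w (y₀ + t • EuclideanSpace.single b (1 : ℝ) + (z - y₀ 2) • EuclideanSpace.single (2 : Fin 3) (1 : ℝ)), z), 1)) z := by
  have hwd : Differentiable ℝ w := hw.differentiable (by norm_num)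
  set y₁ : EuclideanSpace ℝ (Fin 3) := y₀ + t • EuclideanSpace.single b (1 : ℝ) with hy₁
  have hy₁2 : y₁ 2 = y₀ 2 := foot_apply_two y₀ hb t
  -- `z' ↦ w(Y(t,z'))` has derivative `∂₂w(Y) = P(p)`
  have hwl : HasDerivAt (fun z' : ℝ => w (y₁ + (z' - y₁ 2) • EuclideanSpace.single (2 : Fin 3) (1 : ℝ)))
      (fderiv ℝ w (y₁ + (z - y₁ 2) • EuclideanSpace.single (2 : Fin 3) (1 : ℝ)) (EuclideanSpace.single (2 : Fin 3) (1 : ℝ))) z :=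
    hasDerivAt_vertical_line (g := w) y₁ (hwd _)
  rw [hy₁2] at hwl
  have hmem : y₁ + (z - y₀ 2) • EuclideanSpace.single (2 : Fin 3) (1 : ℝ) ∈ U := hY
  rw [hP _ hmem] at hwl
  have h2 : (y₁ + (z - y₀ 2) • EuclideanSpace.single (2 : Fin 3) (1 : ℝ)) 2 = z := plane_apply_two y₀ hb t z
  rw [h2] at hwl
  have hpair : HasDerivAt (fun z' : ℝ => (w (y₁ + (z' - y₀ 2) • EuclideanSpace.single (2 : Fin 3) (1 : ℝ)), z'))
      (P (w (y₁ + (z - y₀ 2) • EuclideanSpace.single (2 : Fin 3) (1 : ℝ)), z), (1 : ℝ)) z := hwl.prodMk (hasDerivAt_id z)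
  have hG' : DifferentiableAt ℝ G (w (y₁ + (z - y₀ 2) • EuclideanSpace.single (2 : Fin 3) (1 : ℝ)), z) := hG
  exact HasFDerivAt.comp_hasDerivAt
    (f := fun z' : ℝ => (w (y₁ + (z' - y₀ 2) • EuclideanSpace.single (2 : Fin 3) (1 : ℝ)), z')) z hG'.hasFDerivAt hpair

/-- **Horizontal derivative of a leafwise quantity along the plane**: `∂_t G(w(Y(t,z)), z) = ∂_b w(Y)·DG(p)(1,0)`. [folklore] -/
theorem hasDerivAt_leaf_plane_horiz (hw : ContDiff ℝ 2 w) (b : Fin 3) (y₀ : EuclideanSpace ℝ (Fin 3)) {G : ℝ × ℝ → ℝ} {t z : ℝ}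
    (hG : DifferentiableAt ℝ G (w (y₀ + t • EuclideanSpace.single b (1 : ℝ) + (z - y₀ 2) • EuclideanSpace.single (2 : Fin 3) (1 : ℝ)), z)) :
    HasDerivAt (fun t' : ℝ => G (w (y₀ + t' • EuclideanSpace.single b (1 : ℝ) + (z - y₀ 2) • EuclideanSpace.single (2 : Fin 3) (1 : ℝ)), z))
      (fderiv ℝ w (y₀ + t • EuclideanSpace.single b (1 : ℝ) + (z - y₀ 2) • EuclideanSpace.single (2 : Fin 3) (1 : ℝ))
          (EuclideanSpace.single b (1 : ℝ)) *
        fderiv ℝ G (w (y₀ + t • EuclideanSpace.single b (1 : ℝ) + (z - y₀ 2) • EuclideanSpace.single (2 : Fin 3) (1 : ℝ)), z) (1, 0)) t := by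
  have hinner := hasDerivAt_w_t hw b y₀ t z
  have houter := hasDerivAt_along_w (z := z) hG
  have h := houter.comp t hinner
  refine h.congr_deriv ?_
  ring

/-- **Vertical derivative of `∂_b w` along the plane**: `∂_z ∂_b w(Y(t,z)) = Pw(p)·∂_b w(Y)`. [folklore] -/
theorem hasDerivAt_wb_z (hU : IsOpen U) (hw : ContDiff ℝ 2 w) (hb : b ≠ 2)
    (hPd : ∀ y ∈ U, DifferentiableAt ℝ P (w y, y 2))
    (hP : ∀ y ∈ U, fderiv ℝ w y (EuclideanSpace.single 2 (1 : ℝ)) = P (w y, y 2)) {t z : ℝ}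
    (hY : y₀ + t • EuclideanSpace.single b (1 : ℝ) + (z - y₀ 2) • EuclideanSpace.single (2 : Fin 3) (1 : ℝ) ∈ U) :
    HasDerivAt (fun z' : ℝ => fderiv ℝ w (y₀ + t • EuclideanSpace.single b (1 : ℝ) + (z' - y₀ 2) • EuclideanSpace.single (2 : Fin 3) (1 : ℝ))
        (EuclideanSpace.single b (1 : ℝ)))
      (fderiv ℝ P (w (y₀ + t • EuclideanSpace.single b (1 : ℝ) + (z - y₀ 2) • EuclideanSpace.single (2 : Fin 3) (1 : ℝ)), z) (1, 0) *
        fderiv ℝ w (y₀ + t • EuclideanSpace.single b (1 : ℝ) + (z - y₀ 2) • EuclideanSpace.single (2 : Fin 3) (1 : ℝ))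
          (EuclideanSpace.single b (1 : ℝ))) z := by
  set y₁ : EuclideanSpace ℝ (Fin 3) := y₀ + t • EuclideanSpace.single b (1 : ℝ) with hy₁
  have hy₁2 : y₁ 2 = y₀ 2 := foot_apply_two y₀ hb t
  have hl : HasDerivAt (fun z' : ℝ => fderiv ℝ w (y₁ + (z' - y₁ 2) • EuclideanSpace.single (2 : Fin 3) (1 : ℝ)) (EuclideanSpace.single b (1 : ℝ)))
      (fderiv ℝ (fun y' => fderiv ℝ w y' (EuclideanSpace.single b (1 : ℝ))) (y₁ + (z - y₁ 2) • EuclideanSpace.single (2 : Fin 3) (1 : ℝ))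
        (EuclideanSpace.single (2 : Fin 3) (1 : ℝ))) z :=
    hasDerivAt_vertical_line (g := fun y' => fderiv ℝ w y' (EuclideanSpace.single b (1 : ℝ))) y₁ (differentiableAt_partial hw _ _)
  rw [hy₁2] at hl
  have hmem : y₁ + (z - y₀ 2) • EuclideanSpace.single (2 : Fin 3) (1 : ℝ) ∈ U := hY
  rw [fderiv_vert_hpartial hU hw hPd hP hmem hb] at hl
  have h2 : (y₁ + (z - y₀ 2) • EuclideanSpace.single (2 : Fin 3) (1 : ℝ)) 2 = z := plane_apply_two y₀ hb t z
  rw [h2] at hl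
  exact hl

/-! ### Constancy of `η` in `t` and the two separations -/

/-- **`η(p(t,z)) = η(p(0,z))` on the Branch-2b region.**  If the horizontal segment `{Y(t′,z) : t′ ∈ uIcc 0 t}` lies in `U`, where `∂₂w = P(w,y₂)`,
`P, Λ ∈ C²` at the leaf points, `Λ ≠ 0` and brick F3a's Wronskian `D₁` vanishes, then `η = Pw + Ld/Λ` takes the same value at `p(t,z)` and `p(0,z)`.
[folklore] -/
theorem eta_const (hw : ContDiff ℝ 2 w) (b : Fin 3) (y₀ : EuclideanSpace ℝ (Fin 3)) {t z : ℝ}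
    (hPc : ∀ t' ∈ uIcc 0 t, ContDiffAt ℝ 2 P (w (y₀ + t' • EuclideanSpace.single b (1 : ℝ) + (z - y₀ 2) • EuclideanSpace.single (2 : Fin 3) (1 : ℝ)), z))
    (hΛc : ∀ t' ∈ uIcc 0 t, ContDiffAt ℝ 2 Λ (w (y₀ + t' • EuclideanSpace.single b (1 : ℝ) + (z - y₀ 2) • EuclideanSpace.single (2 : Fin 3) (1 : ℝ)), z))
    (hL0 : ∀ t' ∈ uIcc 0 t, Λ (w (y₀ + t' • EuclideanSpace.single b (1 : ℝ) + (z - y₀ 2) • EuclideanSpace.single (2 : Fin 3) (1 : ℝ)), z) ≠ 0)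
    (hD1 : ∀ t' ∈ uIcc 0 t, let y := y₀ + t' • EuclideanSpace.single b (1 : ℝ) + (z - y₀ 2) • EuclideanSpace.single (2 : Fin 3) (1 : ℝ)
      Λ (w y, z) * (Λ (w y, z) * fderiv ℝ (fun q => fderiv ℝ P q ((1 : ℝ), (0 : ℝ))) (w y, z) (1, 0) +
            fderiv ℝ (fun q => fderiv ℝ Λ q ((1 : ℝ), (0 : ℝ))) (w y, z) (P (w y, z), 1) +
            2 * fderiv ℝ Λ (w y, z) (1, 0) * fderiv ℝ P (w y, z) (1, 0)) -
          fderiv ℝ Λ (w y, z) (1, 0) * (fderiv ℝ Λ (w y, z) (P (w y, z), 1) + Λ (w y, z) * fderiv ℝ P (w y, z) (1, 0)) = 0) :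
    fderiv ℝ P (w (y₀ + t • EuclideanSpace.single b (1 : ℝ) + (z - y₀ 2) • EuclideanSpace.single (2 : Fin 3) (1 : ℝ)), z) ((1 : ℝ), (0 : ℝ)) +
        fderiv ℝ Λ (w (y₀ + t • EuclideanSpace.single b (1 : ℝ) + (z - y₀ 2) • EuclideanSpace.single (2 : Fin 3) (1 : ℝ)), z)
            (P (w (y₀ + t • EuclideanSpace.single b (1 : ℝ) + (z - y₀ 2) • EuclideanSpace.single (2 : Fin 3) (1 : ℝ)), z), 1) /
          Λ (w (y₀ + t • EuclideanSpace.single b (1 : ℝ) + (z - y₀ 2) • EuclideanSpace.single (2 : Fin 3) (1 : ℝ)), z) =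
      fderiv ℝ P (w (y₀ + (0 : ℝ) • EuclideanSpace.single b (1 : ℝ) + (z - y₀ 2) • EuclideanSpace.single (2 : Fin 3) (1 : ℝ)), z) ((1 : ℝ), (0 : ℝ)) +
        fderiv ℝ Λ (w (y₀ + (0 : ℝ) • EuclideanSpace.single b (1 : ℝ) + (z - y₀ 2) • EuclideanSpace.single (2 : Fin 3) (1 : ℝ)), z)
            (P (w (y₀ + (0 : ℝ) • EuclideanSpace.single b (1 : ℝ) + (z - y₀ 2) • EuclideanSpace.single (2 : Fin 3) (1 : ℝ)), z), 1) /
          Λ (w (y₀ + (0 : ℝ) • EuclideanSpace.single b (1 : ℝ) + (z - y₀ 2) • EuclideanSpace.single (2 : Fin 3) (1 : ℝ)), z) :=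
  eq_of_hasDerivAt_zero (f := fun t' : ℝ =>
      fderiv ℝ P (w (y₀ + t' • EuclideanSpace.single b (1 : ℝ) + (z - y₀ 2) • EuclideanSpace.single (2 : Fin 3) (1 : ℝ)), z) ((1 : ℝ), (0 : ℝ)) +
        fderiv ℝ Λ (w (y₀ + t' • EuclideanSpace.single b (1 : ℝ) + (z - y₀ 2) • EuclideanSpace.single (2 : Fin 3) (1 : ℝ)), z)
            (P (w (y₀ + t' • EuclideanSpace.single b (1 : ℝ) + (z - y₀ 2) • EuclideanSpace.single (2 : Fin 3) (1 : ℝ)), z), 1) /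
          Λ (w (y₀ + t' • EuclideanSpace.single b (1 : ℝ) + (z - y₀ 2) • EuclideanSpace.single (2 : Fin 3) (1 : ℝ)), z))
    (fun t' ht' => hasDerivAt_eta_t_zero hw b y₀ (hPc t' ht') (hΛc t' ht') (hL0 t' ht') (hD1 t' ht'))

/-- **Multiplicative separation of a leafwise quantity transported by `η`.**  Let `F(t,·)` (for the two values `t` and `0`) satisfy along the plane
`∂_z F(t,z) = η(p(t,z))·F(t,z)` on the vertical segment between `z₀ = (y₀)₂` and `z`, with `η(p(t,ζ)) = η(p(0,ζ))` there and `η(p(0,·))` continuous;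
then `F(t,z)·F(0,z₀) = F(t,z₀)·F(0,z)`. (Brick F4-tr-b.) [folklore] -/
theorem separation_of_eta_transport {F : ℝ → ℝ → ℝ} {η₀ ηt : ℝ → ℝ} {t z : ℝ} (y₀ : EuclideanSpace ℝ (Fin 3))
    (hFt : ∀ ζ ∈ uIcc (y₀ 2) z, HasDerivAt (F t) (ηt ζ * F t ζ) ζ)
    (hF0 : ∀ ζ ∈ uIcc (y₀ 2) z, HasDerivAt (F 0) (η₀ ζ * F 0 ζ) ζ)
    (hconst : ∀ ζ ∈ uIcc (y₀ 2) z, ηt ζ = η₀ ζ) (hcont : ContinuousOn η₀ (uIcc (y₀ 2) z)) :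
    F t z * F 0 (y₀ 2) = F t (y₀ 2) * F 0 z :=
  proportional_of_transport (f := F t) (g := F 0) (a := η₀) hcont
    (fun ζ hζ => ⟨by rw [← hconst ζ hζ]; exact hFt ζ hζ, hF0 ζ hζ⟩)

end Plane

end Summit.NavierStokesRegularity.NavierStokesRegularity.Theorems.PoloidalWindowDoorPoloidalWindowRigidityUntwistedStuartTranslation2

end
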